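import Summits.ResolutionOfSingularities.ResolutionOfSingularities.Theorems.PurelyInseparableDim4SwapTransportWindowStepPrime
import Summits.ResolutionOfSingularities.ResolutionOfSingularities.Theorems.PurelyInseparableDim4FreeTail
import HarnessLib
import HarnessLib.Audit.Tags

/-!
# Purely inseparable four-folds — THE VIRTUAL WINDOW FOR EVERY PRIME `p`, ITERATED: `T` real steps (slot steps or rotations) of
# the light-pair power-cone chain are shadowed by `T` PURE slot steps of the framed virtual partner (cell `res-dim4-pi`, K2(p)
# lane, rung-1 POWER-CONE LINE «light pair of TAIL(p, p−1, 3) ∀ p», window half W5a; the `p = 5` instance is §1–§2 of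
# res-dim4-typ-1 g3's `…SwapTransportWindowIter` p701850; the game is played on the shadow in W5b `…SwapTransportWindowPlayPrime`)

[OURS · counted 0 · cell `res-dim4-pi` · K2(p) lane (holder res-dim4-p-12 g5, rulings g5-2 (6) / g5-6) · seat res-dim4-typ-1 g5; the
game half is res-dim4-p-3 g5's `…CInfCornerWindowPrime` over res-dim4-p-9's C∞ game with the window constant of
`…CInfGameWindowPrime` (`T ≥ 4(d − 1) + 2`).]  Nothing here proves K2(p) for any `p`, any TAIL(p, p−1, 3), any TAIL(7, d, e),
`NoIsolatedTrap p p` or resolution of singularities in dimension ≥ 4 / characteristic `p` — NOT proved.  AI kernel work, weaker than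
expert review.  This file closes nothing by itself: it reduces the light pair of every TAIL(p, p−1, 3) to the ENTRY (a framed virtual
partner at ONE real time, res-dim4-p-3's port of `exists_cInf_virtual_entry_rel/_of_rotation`) plus a virtual letter change.

* §1 **`virtual_step_any_prime`** — one real step of any kind (slot step in either slot chart, or rotation through either free letter
  dropping either slot), read through W1a `step_cases_of_weights_prime`, is shadowed by the pure virtual slot step in the chart
  `ℓ ∈ {λ, μ}` given by the RECURSION RULE `ℓ = if jr = π λ then λ else if jr = π μ then μ else if b (π λ) ≠ 0 then λ else μ`, new
  bijection `π⁺ = if jr ∈ {π λ, π μ} then π else π ∘ (ℓ π⁻¹(jr))` (W4 `virtual_step_slot_prime` / `virtual_step_rotate_prime` in both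
  orientations); relation at precision `M − p`, frame at jet `N − d`.
* §2 **`virtual_iterate_prime`** — the shadow follows the real chain for any number `T` of steps (budgets `Nc + 2p + 2 + p·T ≤ M`,
  `d + 4 + d·T ≤ N`; at step `t` the precision is `M − p·t` and the jet `N − d·t`).
* (W5b `…SwapTransportWindowPlayPrime`: `virtual_window_false_of_entry_prime` plays res-dim4-p-3 g5's finite game
  `ResCone.no_cInf_corner_window_prime` on the shadow — split off so that this file does not wait for that import.)
DICTIONARY against `5`: `6 ↦ d + 2`, `x_f⁴ ↦ x_f^d`, `e_f ≤ 3 ↦ e_f ≤ d − 1`, dead «ū²» ↦ ROW `(eu, ef)` with `eu + ef = d − 2` (the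
line owner's GO on Q-FLAG, bus 2026-08-29 10:50Z), flag `3u ↦ (eu+1)u + ef·f`, budgets
`Nc + 7 + 5T ≤ M ↦ Nc + 2p + 2 + pT ≤ M`, `8 + 4T ≤ N ↦ d + 4 + dT ≤ N`, window `9 ↦ T + 1`, `T ≥ 4(d−1) + 2`.
[cite: Hauser2010, §§F–G] [cite: CossartJannsenSaito2020, Thm. 3.14]
bears_on: LADDER-RESOLUTION:D157-DOOR2 (res-dim4-pi · K2(p) · power cones · virtual window ∀ p).  Supports
stmt-ResolutionOfSingularities-16155 (helper).
-/

set_option linter.dupNamespace false -- mandated namespace of this single-conjunct summit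

noncomputable section

namespace Summit.ResolutionOfSingularities.ResolutionOfSingularities.Theorems.PIDim4

namespace SwapTransport

open MvPolynomial Finset
open Literature.AlgebraicGeometry.Resolution
open Literature.AlgebraicGeometry.Resolution.CentreBlowup
open Literature.AlgebraicGeometry.Resolution.Hauser2010
open Literature.AlgebraicGeometry.Resolution.HauserPerlega2019

variable {K : Type} [Field K] [DecidableEq K]

/-! ## §1 One real step of any kind, every prime -/

/-- **ONE REAL STEP OF ANY KIND, SHADOWED, every prime** (see the module docstring, §1). [OURS] [cite: Hauser2010, §§F–G]
[cite: CossartJannsenSaito2020, Thm. 3.14] -/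
theorem virtual_step_any_prime (p : ℕ) [Fact p.Prime] [CharP K p] {d : ℕ} (hdp : d + 1 = p) (hd2 : 2 ≤ d) {eu ef : ℕ}
    (hef : eu + ef = d - 2) {la mu u f : Fin 4} (hlm : la ≠ mu) (hlu : la ≠ u) (hlf : la ≠ f) (hmu : mu ≠ u) (hmf : mu ≠ f) (huf : u ≠ f)
    {π : Equiv.Perm (Fin 4)} {A B : State K} {M N Nc : ℕ}
    (hrel : ∃ (θ e : Fin 4 → MvPolynomial (Fin 4) K) (U E : MvPolynomial (Fin 4) K),
      θ (π la) = X la * e la ∧ θ (π mu) = X mu * e mu ∧ constantCoeff (e la) ≠ 0 ∧ constantCoeff (e mu) ≠ 0 ∧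
      constantCoeff (θ (π u)) = 0 ∧ constantCoeff (θ (π f)) = 0 ∧
      coeff (Finsupp.single u 1) (θ (π u)) * coeff (Finsupp.single f 1) (θ (π f)) -
        coeff (Finsupp.single f 1) (θ (π u)) * coeff (Finsupp.single u 1) (θ (π f)) ≠ 0 ∧
      constantCoeff U ≠ 0 ∧ E ∈ originIdeal K ^ M ∧ B.F = deletePthPowers p (U ^ p * aeval θ A.F) + E)
    (hrA : A.r = Finsupp.single (π la) 1 + Finsupp.single (π mu) 1) (hoA : ordZero A.F = ((d + 2 : ℕ) : ℕ∞))
    (hfr : ordZero B.F = ((d + 2 : ℕ) : ℕ∞) ∧ B.r = Finsupp.single la 1 + Finsupp.single mu 1 ∧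
      (∀ e ∈ B.F.support, B.r ≤ e) ∧ (∃ a : K, a ≠ 0 ∧ ResCone.resForm B = C a * X f ^ d) ∧
      (∀ e ∈ B.F.support, e f ≤ d - 1 → 2 ≤ e la ∧ 2 ≤ e mu) ∧
      (∀ e ∈ B.F.support, e.degree < N → ¬ (e u = eu ∧ e f = ef)) ∧
      coeff (B.r + (Finsupp.single la 1 + Finsupp.single mu 1 + Finsupp.single u (eu + 1) + Finsupp.single f ef)) B.F ≠ 0 ∧
      IsIsolated p B.F ∧ Module.finrank K (ResCone.resVertex B) = 3)
    {jr : Fin 4} {b : Fin 4 → K} (hbj : b jr = 0) {A' : State K} (hstep : A' = CentreBlowup.step p Finset.univ jr b A)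
    (hisoA' : IsIsolated p A'.F) (hcert : originIdeal K ^ Nc ≤ singLocusIdeal p A'.F ⊔ originIdeal K ^ (Nc + 1))
    (hoA' : ordZero A'.F = ((d + 2 : ℕ) : ℕ∞)) (he3A' : Module.finrank K (ResCone.resVertex A') = 3) (hw1 : ∀ i, A'.r i ≤ 1)
    (hdegA' : A'.r.degree = 2) (hdivA' : ∀ e ∈ A'.F.support, A'.r ≤ e) (hM : Nc + 2 * p + 2 ≤ M) (hN : d + 4 ≤ N) :
    ∃ (ℓ : Fin 4) (π' : Equiv.Perm (Fin 4)), (ℓ = la ∨ ℓ = mu) ∧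
      (ℓ = if jr = π la then la else if jr = π mu then mu else if b (π la) ≠ 0 then la else mu) ∧
      (π' = if jr = π la ∨ jr = π mu then π else (Equiv.swap ℓ (π.symm jr)).trans π) ∧
      (∃ (θ' e' : Fin 4 → MvPolynomial (Fin 4) K) (U' E' : MvPolynomial (Fin 4) K),
        θ' (π' la) = X la * e' la ∧ θ' (π' mu) = X mu * e' mu ∧ constantCoeff (e' la) ≠ 0 ∧ constantCoeff (e' mu) ≠ 0 ∧
        constantCoeff (θ' (π' u)) = 0 ∧ constantCoeff (θ' (π' f)) = 0 ∧
        coeff (Finsupp.single u 1) (θ' (π' u)) * coeff (Finsupp.single f 1) (θ' (π' f)) -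
          coeff (Finsupp.single f 1) (θ' (π' u)) * coeff (Finsupp.single u 1) (θ' (π' f)) ≠ 0 ∧
        constantCoeff U' ≠ 0 ∧ E' ∈ originIdeal K ^ (M - p) ∧
        (CentreBlowup.step p Finset.univ ℓ 0 B).F = deletePthPowers p (U' ^ p * aeval θ' A'.F) + E') ∧
      A'.r = Finsupp.single (π' la) 1 + Finsupp.single (π' mu) 1 ∧
      (ordZero (CentreBlowup.step p Finset.univ ℓ 0 B).F = ((d + 2 : ℕ) : ℕ∞) ∧
        (CentreBlowup.step p Finset.univ ℓ 0 B).r = Finsupp.single la 1 + Finsupp.single mu 1 ∧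
        (∀ e ∈ (CentreBlowup.step p Finset.univ ℓ 0 B).F.support, (CentreBlowup.step p Finset.univ ℓ 0 B).r ≤ e) ∧
        (∃ a : K, a ≠ 0 ∧ ResCone.resForm (CentreBlowup.step p Finset.univ ℓ 0 B) = C a * X f ^ d) ∧
        (∀ e ∈ (CentreBlowup.step p Finset.univ ℓ 0 B).F.support, e f ≤ d - 1 → 2 ≤ e la ∧ 2 ≤ e mu) ∧
        (∀ e ∈ (CentreBlowup.step p Finset.univ ℓ 0 B).F.support, e.degree < N - d → ¬ (e u = eu ∧ e f = ef)) ∧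
        coeff ((CentreBlowup.step p Finset.univ ℓ 0 B).r +
          (Finsupp.single la 1 + Finsupp.single mu 1 + Finsupp.single u (eu + 1) + Finsupp.single f ef)) (CentreBlowup.step p Finset.univ ℓ 0 B).F ≠ 0 ∧
        IsIsolated p (CentreBlowup.step p Finset.univ ℓ 0 B).F ∧
        Module.finrank K (ResCone.resVertex (CentreBlowup.step p Finset.univ ℓ 0 B)) = 3) := by
  obtain ⟨θ, e, U, E, hθa, hθa', hea, hea', hu0, hf0, hdet, hU, hE, hrelF⟩ := hrel
  obtain ⟨hoB, hrB, hdivB, ⟨a, ha, hformB⟩, hledB, hrowB, hVB, -, -⟩ := hfr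
  have hdp2 : d + 2 = p + 1 := by omega
  have hoA1 : ordZero A.F = ((p + 1 : ℕ) : ℕ∞) := by rw [hoA, hdp2]
  have hπlm : π la ≠ π mu := fun h => hlm (π.injective h)
  have hπlu : π la ≠ π u := fun h => hlu (π.injective h)
  have hπlf : π la ≠ π f := fun h => hlf (π.injective h)
  have hπmu : π mu ≠ π u := fun h => hmu (π.injective h)
  have hπmf : π mu ≠ π f := fun h => hmf (π.injective h)
  have hπuf : π u ≠ π f := fun h => huf (π.injective h)
  have hw1' : ∀ i, (CentreBlowup.step p Finset.univ jr b A).r i ≤ 1 := fun i => by rw [← hstep]; exact hw1 i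
  have hdeg' : (CentreBlowup.step p Finset.univ jr b A).r.degree = 2 := by rw [← hstep]; exact hdegA'
  -- the swapped-orientation copies of the inputs
  have hrAs : A.r = Finsupp.single (π mu) 1 + Finsupp.single (π la) 1 := by rw [hrA, add_comm]
  have hrBs : B.r = Finsupp.single mu 1 + Finsupp.single la 1 := by rw [hrB, add_comm]
  have hledBs : ∀ e ∈ B.F.support, e f ≤ d - 1 → 2 ≤ e mu ∧ 2 ≤ e la := fun e he hf => (hledB e he hf).symm
  have hVBs : coeff (B.r + (Finsupp.single mu 1 + Finsupp.single la 1 + Finsupp.single u (eu + 1) + Finsupp.single f ef)) B.F ≠ 0 := by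
    rw [add_comm (Finsupp.single mu 1) (Finsupp.single la 1)]; exact hVB
  rcases step_cases_of_weights_prime p hπlm hπlu hπlf hπmu hπmf hπuf hrA hoA1 (jr := jr) (b := b) hw1' hdeg' with
    ⟨hjr, hbmu, -⟩ | ⟨hjr, hbla, -⟩ | ⟨hjr, hrot⟩
  · -- slot step in the chart of `π λ`
    subst hjr
    obtain ⟨-, hrA', θ', e', U', E', h1, h2, h3, h4, h5, h6, h7, h8, h9, h10, hfr'⟩ :=
      virtual_step_slot_prime p hdp hd2 hlm hlu hlf hmu hmf huf hθa hθa' hea hea' hu0 hf0 hdet hU hE hrelF hoA hrA hbj hstep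
        hisoA' hcert hoA' he3A' hw1 hdegA' hdivA' hoB hrB hdivB ha hformB hledB hef hN hrowB hVB hM
    refine ⟨la, π, Or.inl rfl, by rw [if_pos rfl], by rw [if_pos (Or.inl rfl)], ⟨θ', e', U', E', h1, h2, h3, h4, h5, h6, h7, h8,
      h9, h10⟩, hrA', hfr'⟩
  · -- slot step in the chart of `π μ`
    subst hjr
    obtain ⟨-, hrA', θ', e', U', E', h1, h2, h3, h4, h5, h6, h7, h8, h9, h10, ho', hr', hdiv', hform', hled', hrow', hV',
      hiso', he3'⟩ :=
      virtual_step_slot_prime p hdp hd2 hlm.symm hmu hmf hlu hlf huf hθa' hθa hea' hea hu0 hf0 hdet hU hE hrelF hoA hrAs hbj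
        hstep hisoA' hcert hoA' he3A' hw1 hdegA' hdivA' hoB hrBs hdivB ha hformB hledBs hef hN hrowB hVBs hM
    refine ⟨mu, π, Or.inr rfl, by rw [if_neg hπlm.symm, if_pos rfl], by rw [if_pos (Or.inr rfl)], ⟨θ', e', U', E', h2, h1,
      h4, h3, h5, h6, h7, h8, h9, h10⟩, by rw [hrA', add_comm], ho', by rw [hr', add_comm], hdiv', hform',
      fun e he hf => (hled' e he hf).symm, hrow', ?_, hiso', he3'⟩
    rw [add_comm (Finsupp.single la 1) (Finsupp.single mu 1)]; exact hV'
  · -- rotation through the free letter `jr = π g`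
    have hjl : jr ≠ π la := by rcases hjr with rfl | rfl <;> [exact hπlu.symm; exact hπlf.symm]
    have hjm : jr ≠ π mu := by rcases hjr with rfl | rfl <;> [exact hπmu.symm; exact hπmf.symm]
    -- the free letter `g` with `jr = π g`, and its partner
    obtain ⟨g, gt, hg, hjg⟩ : ∃ g gt : Fin 4, ((g = u ∧ gt = f) ∨ (g = f ∧ gt = u)) ∧ jr = π g := by
      rcases hjr with h | h
      · exact ⟨u, f, Or.inl ⟨rfl, rfl⟩, h⟩
      · exact ⟨f, u, Or.inr ⟨rfl, rfl⟩, h⟩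
    subst hjg
    have hsymm : π.symm (π g) = g := π.symm_apply_apply g
    rcases hrot with ⟨hbla, hbmu, hr'⟩ | ⟨hbmu, hbla, hr'⟩
    · -- the slot `π λ` is translated away: virtual chart `λ`
      have hrA'g : A'.r = Finsupp.single (π g) 1 + Finsupp.single (π mu) 1 := by rw [hstep, hr']
      obtain ⟨π', θ', e', U', E', hπ', -, -, -, -, h1, h2, h3, h4, h5, h6, h7, h8, h9, h10, hfr'⟩ :=
        virtual_step_rotate_prime p hdp hd2 hlm hlu hlf hmu hmf huf hg hθa hθa' hea hea' hu0 hf0 hdet hU hE hrelF hoA hbj hbla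
          hbmu hstep hisoA' hcert hoA' he3A' hrA'g hdivA' hoB hrB hdivB ha hformB hledB hef hN hrowB hVB hM
      have hπ'l : π' la = π g := by rw [hπ', Equiv.trans_apply, Equiv.swap_apply_left]
      have hπ'm : π' mu = π mu := by
        have hmg : mu ≠ g := by rcases hg with ⟨rfl, -⟩ | ⟨rfl, -⟩ <;> [exact hmu; exact hmf]
        rw [hπ', Equiv.trans_apply, Equiv.swap_apply_of_ne_of_ne hlm.symm hmg]
      refine ⟨la, π', Or.inl rfl, by rw [if_neg hjl, if_neg hjm, if_pos hbla], by rw [if_neg (not_or.mpr ⟨hjl, hjm⟩), hsymm, hπ'],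
        ⟨θ', e', U', E', h1, h2, h3, h4, h5, h6, h7, h8, h9, h10⟩, by rw [hrA'g, hπ'l, hπ'm], hfr'⟩
    · -- the slot `π μ` is translated away: virtual chart `μ`
      have hrA'g : A'.r = Finsupp.single (π g) 1 + Finsupp.single (π la) 1 := by rw [hstep, hr']
      obtain ⟨π', θ', e', U', E', hπ', -, -, -, -, h1, h2, h3, h4, h5, h6, h7, h8, h9, h10, ho', hr'', hdiv', hform', hled',
        hrow', hV', hiso', he3'⟩ :=
        virtual_step_rotate_prime p hdp hd2 hlm.symm hmu hmf hlu hlf huf hg hθa' hθa hea' hea hu0 hf0 hdet hU hE hrelF hoA hbj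
          hbmu hbla hstep hisoA' hcert hoA' he3A' hrA'g hdivA' hoB hrBs hdivB ha hformB hledBs hef hN hrowB hVBs hM
      have hπ'm : π' mu = π g := by rw [hπ', Equiv.trans_apply, Equiv.swap_apply_left]
      have hπ'l : π' la = π la := by
        have hlg : la ≠ g := by rcases hg with ⟨rfl, -⟩ | ⟨rfl, -⟩ <;> [exact hlu; exact hlf]
        rw [hπ', Equiv.trans_apply, Equiv.swap_apply_of_ne_of_ne hlm hlg]
      have hbla' : ¬ b (π la) ≠ 0 := fun h => h hbla
      refine ⟨mu, π', Or.inr rfl, by rw [if_neg hjl, if_neg hjm, if_neg hbla'],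
        by rw [if_neg (not_or.mpr ⟨hjl, hjm⟩), hsymm, hπ'], ⟨θ', e', U', E', h2, h1, h4, h3, h5, h6, h7, h8, h9, h10⟩,
        by rw [hrA'g, hπ'l, hπ'm, add_comm], ho', by rw [hr'', add_comm], hdiv', hform', fun e he hf => (hled' e he hf).symm,
        hrow', ?_, hiso', he3'⟩
      rw [add_comm (Finsupp.single la 1) (Finsupp.single mu 1)]; exact hV'

/-! ## §2 Iteration through any number of real steps, every prime -/

/-- **THE SHADOW FOLLOWS THE REAL CHAIN, every prime** for `T` steps of any kind: the relation (precision `M − p·t`), the real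
ledger along `πs t` and the frame (jet `N − d·t`) at every `t ≤ T`, from an entry at `t = 0` and the virtual data generated by the
recursion rule; budgets `Nc + 2p + 2 + p·T ≤ M`, `d + 4 + d·T ≤ N`. [OURS] [cite: Hauser2010, §§F–G] -/
theorem virtual_iterate_prime (p : ℕ) [Fact p.Prime] [CharP K p] {d : ℕ} (hdp : d + 1 = p) (hd2 : 2 ≤ d) {eu ef : ℕ}
    (hef : eu + ef = d - 2) {la mu u f : Fin 4} (hlm : la ≠ mu) (hlu : la ≠ u) (hlf : la ≠ f) (hmu : mu ≠ u) (hmf : mu ≠ f) (huf : u ≠ f)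
    {c : ℕ → State K} {j : ℕ → Fin 4} {b : ℕ → Fin 4 → K} (hw : FreeTail.IsWitnessedChain p c j b) {k Nc T : ℕ}
    (hisoR : ∀ t, t ≤ T → IsIsolated p (c (k + t)).F)
    (hcert : ∀ t, t ≤ T → originIdeal K ^ Nc ≤ singLocusIdeal p (c (k + t)).F ⊔ originIdeal K ^ (Nc + 1))
    (hoR : ∀ t, t ≤ T → ordZero (c (k + t)).F = ((d + 2 : ℕ) : ℕ∞))
    (he3R : ∀ t, t ≤ T → Module.finrank K (ResCone.resVertex (c (k + t))) = 3)
    (hwtR : ∀ t, t ≤ T → (∀ i, (c (k + t)).r i ≤ 1) ∧ (c (k + t)).r.degree = 2)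
    (hdivR : ∀ t, t ≤ T → ∀ e ∈ (c (k + t)).F.support, (c (k + t)).r ≤ e)
    {πs : ℕ → Equiv.Perm (Fin 4)} {Bs : ℕ → State K} {ℓs : ℕ → Fin 4}
    (hBs : ∀ t, Bs (t + 1) = CentreBlowup.step p Finset.univ (ℓs t) 0 (Bs t))
    (hℓs : ∀ t, ℓs t = if j (k + t) = πs t la then la else if j (k + t) = πs t mu then mu
      else if b (k + t) (πs t la) ≠ 0 then la else mu)
    (hπs : ∀ t, πs (t + 1) = if j (k + t) = πs t la ∨ j (k + t) = πs t mu then πs t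
      else (Equiv.swap (ℓs t) ((πs t).symm (j (k + t)))).trans (πs t))
    {M N : ℕ} (hM : Nc + 2 * p + 2 + p * T ≤ M) (hN : d + 4 + d * T ≤ N)
    (hrel0 : ∃ (θ e : Fin 4 → MvPolynomial (Fin 4) K) (U E : MvPolynomial (Fin 4) K),
      θ (πs 0 la) = X la * e la ∧ θ (πs 0 mu) = X mu * e mu ∧ constantCoeff (e la) ≠ 0 ∧ constantCoeff (e mu) ≠ 0 ∧
      constantCoeff (θ (πs 0 u)) = 0 ∧ constantCoeff (θ (πs 0 f)) = 0 ∧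
      coeff (Finsupp.single u 1) (θ (πs 0 u)) * coeff (Finsupp.single f 1) (θ (πs 0 f)) -
        coeff (Finsupp.single f 1) (θ (πs 0 u)) * coeff (Finsupp.single u 1) (θ (πs 0 f)) ≠ 0 ∧
      constantCoeff U ≠ 0 ∧ E ∈ originIdeal K ^ M ∧ (Bs 0).F = deletePthPowers p (U ^ p * aeval θ (c k).F) + E)
    (hrA0 : (c k).r = Finsupp.single (πs 0 la) 1 + Finsupp.single (πs 0 mu) 1)
    (hfr0 : ordZero (Bs 0).F = ((d + 2 : ℕ) : ℕ∞) ∧ (Bs 0).r = Finsupp.single la 1 + Finsupp.single mu 1 ∧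
      (∀ e ∈ (Bs 0).F.support, (Bs 0).r ≤ e) ∧ (∃ a : K, a ≠ 0 ∧ ResCone.resForm (Bs 0) = C a * X f ^ d) ∧
      (∀ e ∈ (Bs 0).F.support, e f ≤ d - 1 → 2 ≤ e la ∧ 2 ≤ e mu) ∧
      (∀ e ∈ (Bs 0).F.support, e.degree < N → ¬ (e u = eu ∧ e f = ef)) ∧
      coeff ((Bs 0).r + (Finsupp.single la 1 + Finsupp.single mu 1 + Finsupp.single u (eu + 1) + Finsupp.single f ef)) (Bs 0).F ≠ 0 ∧
      IsIsolated p (Bs 0).F ∧ Module.finrank K (ResCone.resVertex (Bs 0)) = 3) :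
    ∀ t, t ≤ T →
      (∃ (θ e : Fin 4 → MvPolynomial (Fin 4) K) (U E : MvPolynomial (Fin 4) K),
        θ (πs t la) = X la * e la ∧ θ (πs t mu) = X mu * e mu ∧ constantCoeff (e la) ≠ 0 ∧ constantCoeff (e mu) ≠ 0 ∧
        constantCoeff (θ (πs t u)) = 0 ∧ constantCoeff (θ (πs t f)) = 0 ∧
        coeff (Finsupp.single u 1) (θ (πs t u)) * coeff (Finsupp.single f 1) (θ (πs t f)) -
          coeff (Finsupp.single f 1) (θ (πs t u)) * coeff (Finsupp.single u 1) (θ (πs t f)) ≠ 0 ∧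
        constantCoeff U ≠ 0 ∧ E ∈ originIdeal K ^ (M - p * t) ∧
        (Bs t).F = deletePthPowers p (U ^ p * aeval θ (c (k + t)).F) + E) ∧
      (c (k + t)).r = Finsupp.single (πs t la) 1 + Finsupp.single (πs t mu) 1 ∧
      (ordZero (Bs t).F = ((d + 2 : ℕ) : ℕ∞) ∧ (Bs t).r = Finsupp.single la 1 + Finsupp.single mu 1 ∧
        (∀ e ∈ (Bs t).F.support, (Bs t).r ≤ e) ∧ (∃ a : K, a ≠ 0 ∧ ResCone.resForm (Bs t) = C a * X f ^ d) ∧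
        (∀ e ∈ (Bs t).F.support, e f ≤ d - 1 → 2 ≤ e la ∧ 2 ≤ e mu) ∧
        (∀ e ∈ (Bs t).F.support, e.degree < N - d * t → ¬ (e u = eu ∧ e f = ef)) ∧
        coeff ((Bs t).r + (Finsupp.single la 1 + Finsupp.single mu 1 + Finsupp.single u (eu + 1) + Finsupp.single f ef)) (Bs t).F ≠ 0 ∧
        IsIsolated p (Bs t).F ∧ Module.finrank K (ResCone.resVertex (Bs t)) = 3) := by
  intro t
  induction t with
  | zero =>
    intro _
    simp only [Nat.mul_zero, Nat.sub_zero, Nat.add_zero]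
    exact ⟨hrel0, hrA0, hfr0⟩
  | succ t ih =>
    intro ht
    obtain ⟨hrel, hrA, hfr⟩ := ih (by omega)
    obtain ⟨-, hbj, -, -, hcs⟩ := hw (k + t)
    have hcs' : c (k + (t + 1)) = CentreBlowup.step p Finset.univ (j (k + t)) (b (k + t)) (c (k + t)) := hcs
    have hpt : p * t + p = p * (t + 1) := (Nat.mul_succ p t).symm
    have hdt : d * t + d = d * (t + 1) := (Nat.mul_succ d t).symm
    have hpT : p * (t + 1) ≤ p * T := Nat.mul_le_mul_left p ht
    have hdT : d * (t + 1) ≤ d * T := Nat.mul_le_mul_left d ht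
    obtain ⟨ℓ, π', -, hℓeq, hπ'eq, hrel', hrA', hfr'⟩ := virtual_step_any_prime p hdp hd2 hef hlm hlu hlf hmu hmf huf hrel hrA
      (hoR t (by omega)) hfr hbj hcs' (hisoR (t + 1) ht) (hcert (t + 1) ht) (hoR (t + 1) ht) (he3R (t + 1) ht)
      (hwtR (t + 1) ht).1 (hwtR (t + 1) ht).2 (hdivR (t + 1) ht) (by omega) (by omega)
    have hℓt : ℓs t = ℓ := by rw [hℓs t, hℓeq]
    have hπt : πs (t + 1) = π' := by rw [hπs t, hπ'eq, hℓt]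
    have hBt : Bs (t + 1) = CentreBlowup.step p Finset.univ ℓ 0 (Bs t) := by rw [hBs t, hℓt]
    have hM5 : M - p * t - p = M - p * (t + 1) := by omega
    have hN4 : N - d * t - d = N - d * (t + 1) := by omega
    rw [hπt, hBt, ← hM5, ← hN4]
    exact ⟨hrel', hrA', hfr'⟩

end SwapTransport

end Summit.ResolutionOfSingularities.ResolutionOfSingularities.Theorems.PIDim4

end
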